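import Summits.HodgeConjecture.HodgeConjecture.Theorems.F0P2fStubEBPinToAutomorphic   -- ★ p810145 EB `stubEB_holds` (brings the U2′ chain, U1′, H411, (D))
import Summits.HodgeConjecture.HodgeConjecture.Theorems.P2StubU4OfParity             -- ★ the registered letter E3 `StubE3OccurrenceParityAt` (TYPE) + `stubU4_of_parity`
import Summits.HodgeConjecture.HodgeConjecture.Theorems.F0P2fStubEPE3finGlobalEps     -- ★ p810280 (F0P2-p03 (g3)): EP `stubEP_holds`, E3fin `stubE3fin_holds`
import Summits.HodgeConjecture.HodgeConjecture.Theorems.H413ThetaPinBridge           -- ★ pin frame names, `two_le_finrank_maximalRealSubfield`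
import Literature.NumberTheory.Rogawski1990.CohomologicalFinComponentIsTheta        -- ★ (C♭)-telescope vocabulary
import Summits.HodgeConjecture.CorCM.B01.Transposition.Item6OmegaChiSplitting      -- ★ `isCompatible_chiSplittingLine` family (E3♭ text)
import HarnessLib

/-!
# Crux `H413`, programme P2 — **THE (C)-LINE E3-FOLD VEHICLE (O50-1 (i) shape, Lines-free): the registered parity letter E3 from the rung-2 road
# `E3♭ + EP + E3fin` with EB ★ INSIDE** — `stubE3_of_E3flat_EP_E3fin : ‹E3♭› → ‹EP› → ‹E3fin› → P2StubU4OfParity.StubE3OccurrenceParityAt`, and the ONE-LETTER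
# fold `stubE3_of_E3flat : ‹E3♭› → P2StubU4OfParity.StubE3OccurrenceParityAt` (EP ∕ E3fin ★ p810280 inside)

Cell hodgecm-mathlib (D-0151), FLOOR 0, crux item H413 = stmt-HodgeConjecture-24833; programme P2; the E3 RE-CUT sub-line `Cruxes/H413/Lines/F0_P2E3ParityRecut.lean` v1
(fb1acab9408b60a7, F0P2-plan (g4) 2026-08-31T04:12Z on F0P2-p04 (g3)'s census ∕ draft; ruling (X3) 03:57:21Z): E3 ⇐ {E3♭ (ENGINE, automorphic currency), EB, EP, E3fin}.
Author F0P2-p04 (g3).  THEOREMS ONLY (no `def`, no instance, no notation, no named fact, no `sorry`); `--supports stmt-HodgeConjecture-24833 --as helper`; imports NO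
`Cruxes/…/Lines` module (s380b ∕ O50-1): the three hypothesis types are the TREE sub-line v1 bodies `StubE3FlatAutomorphicParity` :124–153, `StubEPGlobalEpsIsLine` :189–193,
`StubE3FinFinite` :198–200 PASTED VERBATIM, the conclusion is the ★ Theorems constant `P2StubU4OfParity.StubE3OccurrenceParityAt` BY NAME, and EB is DISCHARGED inside by ★ p810145
`F0P2fStubEBPinToAutomorphic.stubEB_holds`.  HC_CM is proved only modulo the printed citations until rung 0 closes; this file discharges no printed citation.

WHY THIS FILE (the registrar's E3-FOLD, F0P2-plan (g4) 04:12:46Z → A-plan1 (g18) (γ)): the (C)-line `Lines/F0_P2CohFinComponentIsThetaC.lean` carries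
`stub_E3_occurrenceParityAt : P2StubU4OfParity.StubE3OccurrenceParityAt := by sorry` (v1.2 :281); it must not import the E3 sub-line (Lines ↔ Lines), so the fold goes through
THIS Theorems twin: `theorem stub_E3_occurrenceParityAt : P2StubU4OfParity.StubE3OccurrenceParityAt := F0P2fE3OfRung2.stubE3_of_E3flat_EP_E3fin stub_E3flat_automorphicParity
‹EP★› ‹E3fin★›` once the (C)-line declares `def StubE3FlatAutomorphicParity` (the new class-U letter, tree sub-line v1 :124–153 VERBATIM) + `theorem stub_E3flat_… := by sorry`
and p03 (g3)'s EP ∕ E3fin closers are ★ — registered letters on 27455: [PK, E3] → [PK, E3♭].  Same pattern as ★ p797808 ∕ p800266 ∕ F0P2-p01 (g3)'s `F0P2eCEOfRung2` (CE-FOLD vehicle).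

PROOF (= the sub-line head `stubE3_of_rung2` with `hEB := stubEB_holds`): at a face, EB ★ turns pin occurrence of `ω_V(t)` into a cotangent-type discrete automorphic `P` on `U(V)`
with finite component `ω_V(t)`; E3♭ is applied AT THE PIN (`K F, ι₁, Hm V, V.sylvesterFrame, sylvesterFrame_J V, V.posDef_of_ne, 2 ≤ [F⁺:ℚ], e₁, frameD V, frameG V, frame_congr V,
ιVE V` pinned by ★ `coe_finFrameCongr`; `(archFactorOf F V).ιinf ∕ .Kc`, `adelicDatum F V` and `rhoTriple (datum413 …) t = rhoAtLine …[e₁] (ιVE V) (r₀.toFun t.ε) t.χ` all by `rfl`)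
at the line `a := r₀.toFun t.ε` (`r₀` the datum's faithful section); EP (`t.ε = locF θ`) + ★ `Rep.locF_toFun` rewrite `locF (r₀.toFun t.ε)` to `t.ε`; E3fin gives `.Finite`.

## References
* [Liu2021] Y. Liu, Camb. J. Math. 9 (2021) = arXiv:2102.11518: Def 4.12, Prop 4.13 (proof l. 2145), Rem 4.14, App. D §D.1.
* [Rogawski1992] J. Rogawski, *The multiplicity formula for A-packets* (1992): Thm 1.1.  [GelbartRogawski1991] Invent. Math. 105: §3 (3.3)–(3.5), Thm 5.1.1.
* [Rogawski1990] Ann. of Math. Stud. 123: §12.3, §13.3, Thm 14.6.4.  [HarrisKudlaSweet1996] J. AMS 9: Thm 6.1.  [Omeara1963] §71 Thm 71:18–19.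
-/

set_option autoImplicit false
-- the mandated namespace has the single-problem summit's repeated segment (`HodgeConjecture.HodgeConjecture`)
set_option linter.dupNamespace false

noncomputable section

namespace Summit.HodgeConjecture.HodgeConjecture.Cruxes.H413.F0P2fE3OfRung2

open scoped TensorProduct Matrix ComplexOrder
open NumberField NumberField.InfinitePlace IsDedekindDomain MeasureTheory
open HodgeCM.Model HodgeCM.Model.LiuIndex HodgeCM.Model.TowerCarrier
open Summit.HodgeConjecture.CorCM.Model
open Literature.AlgebraicGeometry.Motives (CMType AbelianVariety)
open Literature.AlgebraicGeometry.HodgeTheory Literature.NumberTheory.Automorphic.PicardCM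
open Literature.AlgebraicGeometry.ShimuraVarieties Literature.AlgebraicGeometry.ShimuraVarieties.UnitaryCanonicalModel
open Literature.NumberTheory.ComplexMultiplication
open Literature.NumberTheory Literature.NumberTheory.Automorphic Literature.NumberTheory.Automorphic.UnitaryGroup
open Literature.NumberTheory.Automorphic.UnitaryGroup.CotangentForms
open Literature.NumberTheory.Automorphic.Liu2021 Literature.NumberTheory.Automorphic.Liu2021.AppendixC
open Literature.NumberTheory.Automorphic.Liu2021.Def411WeilCarriers
open Literature.NumberTheory.Automorphic.Liu2021.Def411WeilCarriersDoubling
open Literature.NumberTheory.Automorphic.IdeleClassGroup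
open Literature.NumberTheory.GelbartRogawski1991 Literature.NumberTheory.GelbartRogawski1991.UnitaryDualPair
open Literature.NumberTheory.GelbartRogawski1991.UnitaryDualPair.WeilCoinv
open Literature.RepresentationTheory Literature.RepresentationTheory.Liu2021
open Literature.NumberTheory.Rogawski1990
open Summit.HodgeConjecture.CorCM
open Summit.HodgeConjecture.CorCM.Transposition
open Summit.HodgeConjecture.CorCM.Transposition.OmegaTransport (realUnit)
open HodgeCM.Model.ArchSideTerm (e₁)
open Literature.NumberTheory.GelbartRogawski1991.OscillatorTripleDictionary (OccursInH1 IsIsoToOmega rhoTriple)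
open MulAction
open Literature.Geometry.ComplexHyperbolic.BallModel (U21 x₀)
open Summit.HodgeConjecture.CorCM.Lines.A3Liu413 (datum413)
open Summit.HodgeConjecture.HodgeConjecture.Cruxes.H413.CohFormsCarriers
open Summit.HodgeConjecture.HodgeConjecture.Cruxes.H413.SpectrumInterfaces
open Summit.HodgeConjecture.HodgeConjecture.Cruxes.H413.ThetaPinBridge (two_le_finrank_maximalRealSubfield)
open Summit.HodgeConjecture.HodgeConjecture.Cruxes.H413.F0P2fStubEBPinToAutomorphic (stubEB_holds)
open Summit.HodgeConjecture.HodgeConjecture.Cruxes.H413.F0P2fStubEPE3finGlobalEps (stubEP_holds stubE3fin_holds)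

set_option synthInstance.maxHeartbeats 400000 in
set_option maxHeartbeats 16000000 in
/-- **The sub-line head restated Lines-free, ALL FOUR stubs explicit** (`E3♭ → EB → EP → E3fin → E3`; hypothesis texts = tree `Lines/F0_P2E3ParityRecut.lean` v1
`StubE3FlatAutomorphicParity` ∕ `StubEBPinToAutomorphic` ∕ `StubEPGlobalEpsIsLine` ∕ `StubE3FinFinite` VERBATIM) — the shape of F0P2-p01 (g3)'s CE-FOLD vehicle ★ p809975
`stubCE_of_PK_GL_LW_LR_LTpu`, for a registrar who prefers to feed the closers by name at the fold site. [cite: Liu2021, Prop. 4.13 (proof l. 2145), Rem. 4.14, Def. 4.12]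
[cite: Rogawski1992, Thm 1.1] [cite: GelbartRogawski1991, Thm 5.1.1 p. 465] -/
theorem stubE3_of_E3flat_EB_EP_E3fin
    (hE :
  ∀ (L : Type) [Field L] [NumberField L] [IsCMField L] (ι : L →+* ℂ) (H : Matrix (Fin 3) (Fin 3) L) (T : GL (Fin 3) ℂ)
    (hT : (T : Matrix (Fin 3) (Fin 3) ℂ)ᴴ * H.map ι * (T : Matrix (Fin 3) (Fin 3) ℂ) = Literature.Geometry.ComplexHyperbolic.BallModel.J),
    (∀ τ' : L →+* ℂ, InfinitePlace.mk τ' ≠ InfinitePlace.mk ι → (H.map τ').PosDef) → 2 ≤ Module.finrank ℚ ↥(maximalRealSubfield L) →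
    ∀ {n' : ℕ} (e₁ : Fin 3 × Fin 1 ≃ Fin n') (dV : Fin 3 → L) (hdV : ∀ i, IsCMField.complexConj L (dV i) = dV i)
      (hdV0 : ∀ i, dV i ≠ 0) (g : GL (Fin 3) L)
      (hg : ((g : Matrix (Fin 3) (Fin 3) L).map (cmConjRingHom L))ᵀ * H * (g : Matrix (Fin 3) (Fin 3) L) = Matrix.diagonal dV)
      (ιV : finAdelic (↥(maximalRealSubfield L)) L (IsCMField.complexConj L) 3 H →*
          finAdelic (↥(maximalRealSubfield L)) L (IsCMField.complexConj L) 3 (Matrix.diagonal dV)),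
        (∀ k, ((ιV k : finAdelic (↥(maximalRealSubfield L)) L (IsCMField.complexConj L) 3 (Matrix.diagonal dV)) :
            GL (Fin 3) (FiniteAdeleRing (𝓞 L) L)) =
          (toFinAdeleGL L 3 g)⁻¹ * (k : GL (Fin 3) (FiniteAdeleRing (𝓞 L) L)) * toFinAdeleGL L 3 g) →
        ∀ (μA : Measure (adelicGroupData (↥(maximalRealSubfield L)) L (IsCMField.complexConj L) 3 H).automorphicQuotient)
          [(adelicGroupData (↥(maximalRealSubfield L)) L (IsCMField.complexConj L) 3 H).IsAutomorphicMeasure μA],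
          ∀ P : DiscreteAutomorphicRep (adelicGroupData (↥(maximalRealSubfield L)) L (IsCMField.complexConj L) 3 H) μA,
            (P.IsHolCotangentAt (cmArchSection L ι H T hT) (cmCompactFactor L ι H T hT) ∨
              P.IsAntiholCotangentAt (cmArchSection L ι H T hT) (cmCompactFactor L ι H T hT)) →
            ∀ (μ : Literature.NumberTheory.Automorphic.IdeleClassGroup L →ₜ* Circle) (hμ : IsConjugateSymplectic L μ), HasWeight L μ 1 →
              ∀ (a : (↥(maximalRealSubfield L))ˣ) (χ : Chi (↥(maximalRealSubfield L)) L (IsCMField.complexConj L)),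
                P.HasFinComponent
                  (rhoAtLine (↥(maximalRealSubfield L)) L (IsCMField.complexConj L) 3 e₁ (Matrix.diagonal dV)
                    (complexConj_imagUnit L) (imagUnit_ne_zero L) (imagUnit_mul_self L) (realDiagonal_isSymm L dV hdV)
                    (isUnit_det_realDiagonal L dV hdV hdV0) (realDiagonal_map L dV hdV).symm
                    (fun a => isCompatible_chiSplittingLine L e₁ dV hdV hdV0 (toHeckeCharacter L μ)
                      (isUnitary_toHeckeCharacter L μ) ((isOscillatorChar_toHeckeCharacter_iff μ).mpr hμ)
                      (TW (↥(maximalRealSubfield L)) a) (isSymm_TW (↥(maximalRealSubfield L)) a)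
                      (isUnit_det_TW (↥(maximalRealSubfield L)) a) (JW (↥(maximalRealSubfield L)) L a)
                      (JW_eq (↥(maximalRealSubfield L)) L a)) ιV a χ) →
                  Even ({v : HeightOneSpectrum (𝓞 ↥(maximalRealSubfield L)) |
                          locF (↥(maximalRealSubfield L)) (imagUnitSq L) a v ≠ 1}.ncard +
                    {φ : L →+* ℂ | φ ∈ hμ.cmType.1 ∧ 0 < (φ (2 * imagUnit L)⁻¹).im}.ncard))
    (hEB :
  ∀ (hDel : Literature.AlgebraicGeometry.ShimuraVarieties.UnitaryCanonicalModel.canonicalModel_exists_printed)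
    (F : HodgeCM.CMField) [IsGalois ℚ F] (h6 : 6 ≤ Module.finrank ℚ F) {ι₁ : F →+* ℂ} (V : HodgeCM.HermSpace3 F ι₁) (a₀ : RealScalar F)
    (Φ : CMType F) (hΦ : ι₁ ∈ Φ.1) (i : (I V (repAt a₀) (muLiu ι₁ GramClass.rep))),
    (datum413 hDel F V a₀ Φ i).n = 3 →
      ∀ (τ' : HodgeCM.CMField.K F →+* ℂ) (t : (datum413 hDel F V a₀ Φ i).Triple), t.HasWeightOne →
        IsGlobalEps (datum413 hDel F V a₀ Φ i) t.ε → OccursInH1 (datum413 hDel F V a₀ Φ i) τ' (rhoTriple (datum413 hDel F V a₀ Φ i) t) →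
          ∃ (μA : Measure (adelicDatum F V).automorphicQuotient) (_ : (adelicDatum F V).IsAutomorphicMeasure μA)
            (P : DiscreteAutomorphicRep (adelicDatum F V) μA),
            (P.IsHolCotangentAt (archFactorOf F V).ιinf (archFactorOf F V).Kc ∨
                P.IsAntiholCotangentAt (archFactorOf F V).ιinf (archFactorOf F V).Kc) ∧
              P.HasFinComponent (rhoTriple (datum413 hDel F V a₀ Φ i) t))
    (hEP :
  ∀ (L : Type) [Field L] [NumberField L] [IsCMField L] (ε : Eps (↥(maximalRealSubfield L)) (imagUnitSq L)),
    (∃ e : L, e ≠ 0 ∧ IsCMField.complexConj L e = -e ∧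
        epsOf (↥(maximalRealSubfield L)) (imagUnitSq L) L (2 * imagUnit L)⁻¹ e = ε) →
      ∃ θ : (↥(maximalRealSubfield L))ˣ, locF (↥(maximalRealSubfield L)) (imagUnitSq L) θ = ε)
    (hfin :
  ∀ (L : Type) [Field L] [NumberField L] [IsCMField L] (θ : (↥(maximalRealSubfield L))ˣ),
    {v : HeightOneSpectrum (𝓞 ↥(maximalRealSubfield L)) | locF (↥(maximalRealSubfield L)) (imagUnitSq L) θ v ≠ 1}.Finite) :
    P2StubU4OfParity.StubE3OccurrenceParityAt := by
  intro hDel F _ h6 ι₁ V a₀ Φ hΦ i hn τ' t hw hε hocc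
  -- EB: the automorphic occurrence at the factor of record
  obtain ⟨μA, hμA, P, hP, hfc⟩ := hEB hDel F h6 V a₀ Φ hΦ i hn τ' t hw hε hocc
  -- EP: the global `ε_t` is the class family of a line `θ`; the datum's section is faithful on it
  obtain ⟨θ, hθ⟩ := hEP (HodgeCM.CMField.K F) t.ε hε
  have hr : locF (↥(maximalRealSubfield (HodgeCM.CMField.K F))) (imagUnitSq (HodgeCM.CMField.K F))
      ((Rep.update (↥(maximalRealSubfield (HodgeCM.CMField.K F))) (imagUnitSq (HodgeCM.CMField.K F))
        (Rep.ofLineOf (↥(maximalRealSubfield (HodgeCM.CMField.K F))) (imagUnitSq (HodgeCM.CMField.K F)))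
        (locF (↥(maximalRealSubfield (HodgeCM.CMField.K F))) (imagUnitSq (HodgeCM.CMField.K F))
          (realUnit ⟨HodgeCM.CMField.K F⟩ (repAt a₀ (Sigma.fst i)).1 (repAt a₀ (Sigma.fst i)).2.1 (repAt a₀ (Sigma.fst i)).2.2))
        (realUnit ⟨HodgeCM.CMField.K F⟩ (repAt a₀ (Sigma.fst i)).1 (repAt a₀ (Sigma.fst i)).2.1 (repAt a₀ (Sigma.fst i)).2.2) rfl).toFun t.ε) =
      t.ε :=
    Rep.locF_toFun _ t.ε ⟨θ, hθ⟩
  refine ⟨?_, ?_⟩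
  · -- E3fin
    rw [← hθ]
    exact hfin (HodgeCM.CMField.K F) θ
  · -- E3♭ at the pin
    have h2 : 2 ≤ Module.finrank ℚ ↥(maximalRealSubfield (HodgeCM.CMField.K F)) :=
      two_le_finrank_maximalRealSubfield (HodgeCM.CMField.K F) h6
    haveI : (UnitaryGroup.adelicGroupData (↥(maximalRealSubfield (HodgeCM.CMField.K F))) (HodgeCM.CMField.K F)
        (IsCMField.complexConj (HodgeCM.CMField.K F)) 3 (HodgeCM.HermSpace3.Hm V)).IsAutomorphicMeasure μA := hμA
    have hpar := hE (HodgeCM.CMField.K F) ι₁ (HodgeCM.HermSpace3.Hm V) V.sylvesterFrame (HodgeCM.Model.sylvesterFrame_J V) V.posDef_of_ne h2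
      e₁ (frameD V) (frameD_real V) (frameD_ne V) (frameG V) (frame_congr V) (ιVE V)
      (fun k => coe_finFrameCongr (HodgeCM.CMField.K F) V.Hm (frameG V) (frameD V) (frame_congr V) k)
      μA P hP t.μ t.isConjugateSymplectic hw
      ((Rep.update (↥(maximalRealSubfield (HodgeCM.CMField.K F))) (imagUnitSq (HodgeCM.CMField.K F))
        (Rep.ofLineOf (↥(maximalRealSubfield (HodgeCM.CMField.K F))) (imagUnitSq (HodgeCM.CMField.K F)))
        (locF (↥(maximalRealSubfield (HodgeCM.CMField.K F))) (imagUnitSq (HodgeCM.CMField.K F))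
          (realUnit ⟨HodgeCM.CMField.K F⟩ (repAt a₀ (Sigma.fst i)).1 (repAt a₀ (Sigma.fst i)).2.1 (repAt a₀ (Sigma.fst i)).2.2))
        (realUnit ⟨HodgeCM.CMField.K F⟩ (repAt a₀ (Sigma.fst i)).1 (repAt a₀ (Sigma.fst i)).2.1 (repAt a₀ (Sigma.fst i)).2.2) rfl).toFun t.ε)
      t.χ hfc
    rw [hr] at hpar
    exact hpar


set_option synthInstance.maxHeartbeats 400000 in
set_option maxHeartbeats 16000000 in
/-- **THE E3-FOLD VEHICLE — the registered parity letter E3 `P2StubU4OfParity.StubE3OccurrenceParityAt` from E3♭ (engine), EP and E3fin (in-house), EB ★ inside.**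
Hypothesis texts = tree `Lines/F0_P2E3ParityRecut.lean` v1 (fb1acab9) `StubE3FlatAutomorphicParity` ∕ `StubEPGlobalEpsIsLine` ∕ `StubE3FinFinite` VERBATIM (so the (C)-line's
fold feeds its own restated `def`s and p03 (g3)'s ★ closers by name, δ-definitionally); proof = the sub-line head `stubE3_of_rung2` with `hEB := F0P2fStubEBPinToAutomorphic.stubEB_holds`
(★ p810145): EB gives the cotangent-type discrete `P` with finite component `ω_V(t)`; E3♭ AT THE PIN (ThetaPinBridge instantiation) at `a := r₀.toFun t.ε`; EP + ★ `Rep.locF_toFun`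
rewrite `locF (r₀.toFun t.ε) = t.ε`; E3fin gives finiteness. [cite: Liu2021, Prop. 4.13 (proof l. 2145), Rem. 4.14, Def. 4.12] [cite: Rogawski1992, Thm 1.1]
[cite: GelbartRogawski1991, §3 (3.3)–(3.5), Thm 5.1.1 p. 465] [cite: Omeara1963, §71 Thm. 71:18] -/
theorem stubE3_of_E3flat_EP_E3fin
    (hE :
  ∀ (L : Type) [Field L] [NumberField L] [IsCMField L] (ι : L →+* ℂ) (H : Matrix (Fin 3) (Fin 3) L) (T : GL (Fin 3) ℂ)
    (hT : (T : Matrix (Fin 3) (Fin 3) ℂ)ᴴ * H.map ι * (T : Matrix (Fin 3) (Fin 3) ℂ) = Literature.Geometry.ComplexHyperbolic.BallModel.J),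
    (∀ τ' : L →+* ℂ, InfinitePlace.mk τ' ≠ InfinitePlace.mk ι → (H.map τ').PosDef) → 2 ≤ Module.finrank ℚ ↥(maximalRealSubfield L) →
    ∀ {n' : ℕ} (e₁ : Fin 3 × Fin 1 ≃ Fin n') (dV : Fin 3 → L) (hdV : ∀ i, IsCMField.complexConj L (dV i) = dV i)
      (hdV0 : ∀ i, dV i ≠ 0) (g : GL (Fin 3) L)
      (hg : ((g : Matrix (Fin 3) (Fin 3) L).map (cmConjRingHom L))ᵀ * H * (g : Matrix (Fin 3) (Fin 3) L) = Matrix.diagonal dV)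
      (ιV : finAdelic (↥(maximalRealSubfield L)) L (IsCMField.complexConj L) 3 H →*
          finAdelic (↥(maximalRealSubfield L)) L (IsCMField.complexConj L) 3 (Matrix.diagonal dV)),
        (∀ k, ((ιV k : finAdelic (↥(maximalRealSubfield L)) L (IsCMField.complexConj L) 3 (Matrix.diagonal dV)) :
            GL (Fin 3) (FiniteAdeleRing (𝓞 L) L)) =
          (toFinAdeleGL L 3 g)⁻¹ * (k : GL (Fin 3) (FiniteAdeleRing (𝓞 L) L)) * toFinAdeleGL L 3 g) →
        ∀ (μA : Measure (adelicGroupData (↥(maximalRealSubfield L)) L (IsCMField.complexConj L) 3 H).automorphicQuotient)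
          [(adelicGroupData (↥(maximalRealSubfield L)) L (IsCMField.complexConj L) 3 H).IsAutomorphicMeasure μA],
          ∀ P : DiscreteAutomorphicRep (adelicGroupData (↥(maximalRealSubfield L)) L (IsCMField.complexConj L) 3 H) μA,
            (P.IsHolCotangentAt (cmArchSection L ι H T hT) (cmCompactFactor L ι H T hT) ∨
              P.IsAntiholCotangentAt (cmArchSection L ι H T hT) (cmCompactFactor L ι H T hT)) →
            ∀ (μ : Literature.NumberTheory.Automorphic.IdeleClassGroup L →ₜ* Circle) (hμ : IsConjugateSymplectic L μ), HasWeight L μ 1 →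
              ∀ (a : (↥(maximalRealSubfield L))ˣ) (χ : Chi (↥(maximalRealSubfield L)) L (IsCMField.complexConj L)),
                P.HasFinComponent
                  (rhoAtLine (↥(maximalRealSubfield L)) L (IsCMField.complexConj L) 3 e₁ (Matrix.diagonal dV)
                    (complexConj_imagUnit L) (imagUnit_ne_zero L) (imagUnit_mul_self L) (realDiagonal_isSymm L dV hdV)
                    (isUnit_det_realDiagonal L dV hdV hdV0) (realDiagonal_map L dV hdV).symm
                    (fun a => isCompatible_chiSplittingLine L e₁ dV hdV hdV0 (toHeckeCharacter L μ)
                      (isUnitary_toHeckeCharacter L μ) ((isOscillatorChar_toHeckeCharacter_iff μ).mpr hμ)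
                      (TW (↥(maximalRealSubfield L)) a) (isSymm_TW (↥(maximalRealSubfield L)) a)
                      (isUnit_det_TW (↥(maximalRealSubfield L)) a) (JW (↥(maximalRealSubfield L)) L a)
                      (JW_eq (↥(maximalRealSubfield L)) L a)) ιV a χ) →
                  Even ({v : HeightOneSpectrum (𝓞 ↥(maximalRealSubfield L)) |
                          locF (↥(maximalRealSubfield L)) (imagUnitSq L) a v ≠ 1}.ncard +
                    {φ : L →+* ℂ | φ ∈ hμ.cmType.1 ∧ 0 < (φ (2 * imagUnit L)⁻¹).im}.ncard))
    (hEP :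
  ∀ (L : Type) [Field L] [NumberField L] [IsCMField L] (ε : Eps (↥(maximalRealSubfield L)) (imagUnitSq L)),
    (∃ e : L, e ≠ 0 ∧ IsCMField.complexConj L e = -e ∧
        epsOf (↥(maximalRealSubfield L)) (imagUnitSq L) L (2 * imagUnit L)⁻¹ e = ε) →
      ∃ θ : (↥(maximalRealSubfield L))ˣ, locF (↥(maximalRealSubfield L)) (imagUnitSq L) θ = ε)
    (hfin :
  ∀ (L : Type) [Field L] [NumberField L] [IsCMField L] (θ : (↥(maximalRealSubfield L))ˣ),
    {v : HeightOneSpectrum (𝓞 ↥(maximalRealSubfield L)) | locF (↥(maximalRealSubfield L)) (imagUnitSq L) θ v ≠ 1}.Finite) :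
    P2StubU4OfParity.StubE3OccurrenceParityAt := by
  intro hDel F _ h6 ι₁ V a₀ Φ hΦ i hn τ' t hw hε hocc
  -- EB ★: the automorphic occurrence at the factor of record
  obtain ⟨μA, hμA, P, hP, hfc⟩ := stubEB_holds hDel F h6 V a₀ Φ hΦ i hn τ' t hw hε hocc
  -- EP: the global `ε_t` is the class family of a line `θ`; the datum's section is faithful on it
  obtain ⟨θ, hθ⟩ := hEP (HodgeCM.CMField.K F) t.ε hε
  have hr : locF (↥(maximalRealSubfield (HodgeCM.CMField.K F))) (imagUnitSq (HodgeCM.CMField.K F))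
      ((Rep.update (↥(maximalRealSubfield (HodgeCM.CMField.K F))) (imagUnitSq (HodgeCM.CMField.K F))
        (Rep.ofLineOf (↥(maximalRealSubfield (HodgeCM.CMField.K F))) (imagUnitSq (HodgeCM.CMField.K F)))
        (locF (↥(maximalRealSubfield (HodgeCM.CMField.K F))) (imagUnitSq (HodgeCM.CMField.K F))
          (realUnit ⟨HodgeCM.CMField.K F⟩ (repAt a₀ (Sigma.fst i)).1 (repAt a₀ (Sigma.fst i)).2.1 (repAt a₀ (Sigma.fst i)).2.2))
        (realUnit ⟨HodgeCM.CMField.K F⟩ (repAt a₀ (Sigma.fst i)).1 (repAt a₀ (Sigma.fst i)).2.1 (repAt a₀ (Sigma.fst i)).2.2) rfl).toFun t.ε) =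
      t.ε :=
    Rep.locF_toFun _ t.ε ⟨θ, hθ⟩
  refine ⟨?_, ?_⟩
  · -- E3fin
    rw [← hθ]
    exact hfin (HodgeCM.CMField.K F) θ
  · -- E3♭ at the pin
    have h2 : 2 ≤ Module.finrank ℚ ↥(maximalRealSubfield (HodgeCM.CMField.K F)) :=
      two_le_finrank_maximalRealSubfield (HodgeCM.CMField.K F) h6
    haveI : (UnitaryGroup.adelicGroupData (↥(maximalRealSubfield (HodgeCM.CMField.K F))) (HodgeCM.CMField.K F)
        (IsCMField.complexConj (HodgeCM.CMField.K F)) 3 (HodgeCM.HermSpace3.Hm V)).IsAutomorphicMeasure μA := hμA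
    have hpar := hE (HodgeCM.CMField.K F) ι₁ (HodgeCM.HermSpace3.Hm V) V.sylvesterFrame (HodgeCM.Model.sylvesterFrame_J V) V.posDef_of_ne h2
      e₁ (frameD V) (frameD_real V) (frameD_ne V) (frameG V) (frame_congr V) (ιVE V)
      (fun k => coe_finFrameCongr (HodgeCM.CMField.K F) V.Hm (frameG V) (frameD V) (frame_congr V) k)
      μA P hP t.μ t.isConjugateSymplectic hw
      ((Rep.update (↥(maximalRealSubfield (HodgeCM.CMField.K F))) (imagUnitSq (HodgeCM.CMField.K F))
        (Rep.ofLineOf (↥(maximalRealSubfield (HodgeCM.CMField.K F))) (imagUnitSq (HodgeCM.CMField.K F)))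
        (locF (↥(maximalRealSubfield (HodgeCM.CMField.K F))) (imagUnitSq (HodgeCM.CMField.K F))
          (realUnit ⟨HodgeCM.CMField.K F⟩ (repAt a₀ (Sigma.fst i)).1 (repAt a₀ (Sigma.fst i)).2.1 (repAt a₀ (Sigma.fst i)).2.2))
        (realUnit ⟨HodgeCM.CMField.K F⟩ (repAt a₀ (Sigma.fst i)).1 (repAt a₀ (Sigma.fst i)).2.1 (repAt a₀ (Sigma.fst i)).2.2) rfl).toFun t.ε)
      t.χ hfc
    rw [hr] at hpar
    exact hpar

set_option synthInstance.maxHeartbeats 400000 in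
set_option maxHeartbeats 16000000 in
/-- **U4 from E3♭ + EP + E3fin** (EB ★ inside; documentation: the (C)-line's U4 is ★-folded over E3 by `P2StubU4OfParity.stubU4_of_parity`).
[cite: Liu2021, Def. 4.12, Rem. 4.14] [cite: Rogawski1992, Thm 1.1] -/
theorem stubU4_of_E3flat_EP_E3fin
    (hE :
  ∀ (L : Type) [Field L] [NumberField L] [IsCMField L] (ι : L →+* ℂ) (H : Matrix (Fin 3) (Fin 3) L) (T : GL (Fin 3) ℂ)
    (hT : (T : Matrix (Fin 3) (Fin 3) ℂ)ᴴ * H.map ι * (T : Matrix (Fin 3) (Fin 3) ℂ) = Literature.Geometry.ComplexHyperbolic.BallModel.J),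
    (∀ τ' : L →+* ℂ, InfinitePlace.mk τ' ≠ InfinitePlace.mk ι → (H.map τ').PosDef) → 2 ≤ Module.finrank ℚ ↥(maximalRealSubfield L) →
    ∀ {n' : ℕ} (e₁ : Fin 3 × Fin 1 ≃ Fin n') (dV : Fin 3 → L) (hdV : ∀ i, IsCMField.complexConj L (dV i) = dV i)
      (hdV0 : ∀ i, dV i ≠ 0) (g : GL (Fin 3) L)
      (hg : ((g : Matrix (Fin 3) (Fin 3) L).map (cmConjRingHom L))ᵀ * H * (g : Matrix (Fin 3) (Fin 3) L) = Matrix.diagonal dV)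
      (ιV : finAdelic (↥(maximalRealSubfield L)) L (IsCMField.complexConj L) 3 H →*
          finAdelic (↥(maximalRealSubfield L)) L (IsCMField.complexConj L) 3 (Matrix.diagonal dV)),
        (∀ k, ((ιV k : finAdelic (↥(maximalRealSubfield L)) L (IsCMField.complexConj L) 3 (Matrix.diagonal dV)) :
            GL (Fin 3) (FiniteAdeleRing (𝓞 L) L)) =
          (toFinAdeleGL L 3 g)⁻¹ * (k : GL (Fin 3) (FiniteAdeleRing (𝓞 L) L)) * toFinAdeleGL L 3 g) →
        ∀ (μA : Measure (adelicGroupData (↥(maximalRealSubfield L)) L (IsCMField.complexConj L) 3 H).automorphicQuotient)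
          [(adelicGroupData (↥(maximalRealSubfield L)) L (IsCMField.complexConj L) 3 H).IsAutomorphicMeasure μA],
          ∀ P : DiscreteAutomorphicRep (adelicGroupData (↥(maximalRealSubfield L)) L (IsCMField.complexConj L) 3 H) μA,
            (P.IsHolCotangentAt (cmArchSection L ι H T hT) (cmCompactFactor L ι H T hT) ∨
              P.IsAntiholCotangentAt (cmArchSection L ι H T hT) (cmCompactFactor L ι H T hT)) →
            ∀ (μ : Literature.NumberTheory.Automorphic.IdeleClassGroup L →ₜ* Circle) (hμ : IsConjugateSymplectic L μ), HasWeight L μ 1 →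
              ∀ (a : (↥(maximalRealSubfield L))ˣ) (χ : Chi (↥(maximalRealSubfield L)) L (IsCMField.complexConj L)),
                P.HasFinComponent
                  (rhoAtLine (↥(maximalRealSubfield L)) L (IsCMField.complexConj L) 3 e₁ (Matrix.diagonal dV)
                    (complexConj_imagUnit L) (imagUnit_ne_zero L) (imagUnit_mul_self L) (realDiagonal_isSymm L dV hdV)
                    (isUnit_det_realDiagonal L dV hdV hdV0) (realDiagonal_map L dV hdV).symm
                    (fun a => isCompatible_chiSplittingLine L e₁ dV hdV hdV0 (toHeckeCharacter L μ)
                      (isUnitary_toHeckeCharacter L μ) ((isOscillatorChar_toHeckeCharacter_iff μ).mpr hμ)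
                      (TW (↥(maximalRealSubfield L)) a) (isSymm_TW (↥(maximalRealSubfield L)) a)
                      (isUnit_det_TW (↥(maximalRealSubfield L)) a) (JW (↥(maximalRealSubfield L)) L a)
                      (JW_eq (↥(maximalRealSubfield L)) L a)) ιV a χ) →
                  Even ({v : HeightOneSpectrum (𝓞 ↥(maximalRealSubfield L)) |
                          locF (↥(maximalRealSubfield L)) (imagUnitSq L) a v ≠ 1}.ncard +
                    {φ : L →+* ℂ | φ ∈ hμ.cmType.1 ∧ 0 < (φ (2 * imagUnit L)⁻¹).im}.ncard))
    (hEP :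
  ∀ (L : Type) [Field L] [NumberField L] [IsCMField L] (ε : Eps (↥(maximalRealSubfield L)) (imagUnitSq L)),
    (∃ e : L, e ≠ 0 ∧ IsCMField.complexConj L e = -e ∧
        epsOf (↥(maximalRealSubfield L)) (imagUnitSq L) L (2 * imagUnit L)⁻¹ e = ε) →
      ∃ θ : (↥(maximalRealSubfield L))ˣ, locF (↥(maximalRealSubfield L)) (imagUnitSq L) θ = ε)
    (hfin :
  ∀ (L : Type) [Field L] [NumberField L] [IsCMField L] (θ : (↥(maximalRealSubfield L))ˣ),
    {v : HeightOneSpectrum (𝓞 ↥(maximalRealSubfield L)) | locF (↥(maximalRealSubfield L)) (imagUnitSq L) θ v ≠ 1}.Finite) :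
    StubU4SignRule :=
  P2StubU4OfParity.stubU4_of_parity (stubE3_of_E3flat_EP_E3fin hE hEP hfin)

set_option synthInstance.maxHeartbeats 400000 in
set_option maxHeartbeats 16000000 in
/-- **THE ONE-LETTER FOLD — E3 from the engine letter E3♭ ALONE** (EB ★ p810145, EP ∕ E3fin ★ p810280 inside): the registrar's (C)-line E3-FOLD token is
`theorem stub_E3_occurrenceParityAt : P2StubU4OfParity.StubE3OccurrenceParityAt := F0P2fE3OfRung2.stubE3_of_E3flat stub_E3flat_automorphicParity` once the (C)-line declares
`def StubE3FlatAutomorphicParity` (tree sub-line v1 :124–153 VERBATIM) with `theorem stub_E3flat_automorphicParity : StubE3FlatAutomorphicParity := by sorry` — registered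
letters [PK, E3] → [PK, E3♭]; and the E3 sub-line v1.1 may fold its own head the same way. [cite: Liu2021, Rem. 4.14, Def. 4.12] [cite: Rogawski1992, Thm 1.1]
[cite: GelbartRogawski1991, Thm 5.1.1 p. 465] -/
theorem stubE3_of_E3flat
    (hE :
  ∀ (L : Type) [Field L] [NumberField L] [IsCMField L] (ι : L →+* ℂ) (H : Matrix (Fin 3) (Fin 3) L) (T : GL (Fin 3) ℂ)
    (hT : (T : Matrix (Fin 3) (Fin 3) ℂ)ᴴ * H.map ι * (T : Matrix (Fin 3) (Fin 3) ℂ) = Literature.Geometry.ComplexHyperbolic.BallModel.J),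
    (∀ τ' : L →+* ℂ, InfinitePlace.mk τ' ≠ InfinitePlace.mk ι → (H.map τ').PosDef) → 2 ≤ Module.finrank ℚ ↥(maximalRealSubfield L) →
    ∀ {n' : ℕ} (e₁ : Fin 3 × Fin 1 ≃ Fin n') (dV : Fin 3 → L) (hdV : ∀ i, IsCMField.complexConj L (dV i) = dV i)
      (hdV0 : ∀ i, dV i ≠ 0) (g : GL (Fin 3) L)
      (hg : ((g : Matrix (Fin 3) (Fin 3) L).map (cmConjRingHom L))ᵀ * H * (g : Matrix (Fin 3) (Fin 3) L) = Matrix.diagonal dV)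
      (ιV : finAdelic (↥(maximalRealSubfield L)) L (IsCMField.complexConj L) 3 H →*
          finAdelic (↥(maximalRealSubfield L)) L (IsCMField.complexConj L) 3 (Matrix.diagonal dV)),
        (∀ k, ((ιV k : finAdelic (↥(maximalRealSubfield L)) L (IsCMField.complexConj L) 3 (Matrix.diagonal dV)) :
            GL (Fin 3) (FiniteAdeleRing (𝓞 L) L)) =
          (toFinAdeleGL L 3 g)⁻¹ * (k : GL (Fin 3) (FiniteAdeleRing (𝓞 L) L)) * toFinAdeleGL L 3 g) →
        ∀ (μA : Measure (adelicGroupData (↥(maximalRealSubfield L)) L (IsCMField.complexConj L) 3 H).automorphicQuotient)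
          [(adelicGroupData (↥(maximalRealSubfield L)) L (IsCMField.complexConj L) 3 H).IsAutomorphicMeasure μA],
          ∀ P : DiscreteAutomorphicRep (adelicGroupData (↥(maximalRealSubfield L)) L (IsCMField.complexConj L) 3 H) μA,
            (P.IsHolCotangentAt (cmArchSection L ι H T hT) (cmCompactFactor L ι H T hT) ∨
              P.IsAntiholCotangentAt (cmArchSection L ι H T hT) (cmCompactFactor L ι H T hT)) →
            ∀ (μ : Literature.NumberTheory.Automorphic.IdeleClassGroup L →ₜ* Circle) (hμ : IsConjugateSymplectic L μ), HasWeight L μ 1 →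
              ∀ (a : (↥(maximalRealSubfield L))ˣ) (χ : Chi (↥(maximalRealSubfield L)) L (IsCMField.complexConj L)),
                P.HasFinComponent
                  (rhoAtLine (↥(maximalRealSubfield L)) L (IsCMField.complexConj L) 3 e₁ (Matrix.diagonal dV)
                    (complexConj_imagUnit L) (imagUnit_ne_zero L) (imagUnit_mul_self L) (realDiagonal_isSymm L dV hdV)
                    (isUnit_det_realDiagonal L dV hdV hdV0) (realDiagonal_map L dV hdV).symm
                    (fun a => isCompatible_chiSplittingLine L e₁ dV hdV hdV0 (toHeckeCharacter L μ)
                      (isUnitary_toHeckeCharacter L μ) ((isOscillatorChar_toHeckeCharacter_iff μ).mpr hμ)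
                      (TW (↥(maximalRealSubfield L)) a) (isSymm_TW (↥(maximalRealSubfield L)) a)
                      (isUnit_det_TW (↥(maximalRealSubfield L)) a) (JW (↥(maximalRealSubfield L)) L a)
                      (JW_eq (↥(maximalRealSubfield L)) L a)) ιV a χ) →
                  Even ({v : HeightOneSpectrum (𝓞 ↥(maximalRealSubfield L)) |
                          locF (↥(maximalRealSubfield L)) (imagUnitSq L) a v ≠ 1}.ncard +
                    {φ : L →+* ℂ | φ ∈ hμ.cmType.1 ∧ 0 < (φ (2 * imagUnit L)⁻¹).im}.ncard)) :
    P2StubU4OfParity.StubE3OccurrenceParityAt :=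
  stubE3_of_E3flat_EP_E3fin hE stubEP_holds stubE3fin_holds

set_option synthInstance.maxHeartbeats 400000 in
set_option maxHeartbeats 16000000 in
/-- **U4 from E3♭ alone** (the parent line's sign rule over the engine's parity letter; EB ∕ EP ∕ E3fin ★ inside, ★ `stubU4_of_parity`).
[cite: Liu2021, Def. 4.12, Rem. 4.14] [cite: Rogawski1992, Thm 1.1] -/
theorem stubU4_of_E3flat
    (hE :
  ∀ (L : Type) [Field L] [NumberField L] [IsCMField L] (ι : L →+* ℂ) (H : Matrix (Fin 3) (Fin 3) L) (T : GL (Fin 3) ℂ)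
    (hT : (T : Matrix (Fin 3) (Fin 3) ℂ)ᴴ * H.map ι * (T : Matrix (Fin 3) (Fin 3) ℂ) = Literature.Geometry.ComplexHyperbolic.BallModel.J),
    (∀ τ' : L →+* ℂ, InfinitePlace.mk τ' ≠ InfinitePlace.mk ι → (H.map τ').PosDef) → 2 ≤ Module.finrank ℚ ↥(maximalRealSubfield L) →
    ∀ {n' : ℕ} (e₁ : Fin 3 × Fin 1 ≃ Fin n') (dV : Fin 3 → L) (hdV : ∀ i, IsCMField.complexConj L (dV i) = dV i)
      (hdV0 : ∀ i, dV i ≠ 0) (g : GL (Fin 3) L)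
      (hg : ((g : Matrix (Fin 3) (Fin 3) L).map (cmConjRingHom L))ᵀ * H * (g : Matrix (Fin 3) (Fin 3) L) = Matrix.diagonal dV)
      (ιV : finAdelic (↥(maximalRealSubfield L)) L (IsCMField.complexConj L) 3 H →*
          finAdelic (↥(maximalRealSubfield L)) L (IsCMField.complexConj L) 3 (Matrix.diagonal dV)),
        (∀ k, ((ιV k : finAdelic (↥(maximalRealSubfield L)) L (IsCMField.complexConj L) 3 (Matrix.diagonal dV)) :
            GL (Fin 3) (FiniteAdeleRing (𝓞 L) L)) =
          (toFinAdeleGL L 3 g)⁻¹ * (k : GL (Fin 3) (FiniteAdeleRing (𝓞 L) L)) * toFinAdeleGL L 3 g) →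
        ∀ (μA : Measure (adelicGroupData (↥(maximalRealSubfield L)) L (IsCMField.complexConj L) 3 H).automorphicQuotient)
          [(adelicGroupData (↥(maximalRealSubfield L)) L (IsCMField.complexConj L) 3 H).IsAutomorphicMeasure μA],
          ∀ P : DiscreteAutomorphicRep (adelicGroupData (↥(maximalRealSubfield L)) L (IsCMField.complexConj L) 3 H) μA,
            (P.IsHolCotangentAt (cmArchSection L ι H T hT) (cmCompactFactor L ι H T hT) ∨
              P.IsAntiholCotangentAt (cmArchSection L ι H T hT) (cmCompactFactor L ι H T hT)) →
            ∀ (μ : Literature.NumberTheory.Automorphic.IdeleClassGroup L →ₜ* Circle) (hμ : IsConjugateSymplectic L μ), HasWeight L μ 1 →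
              ∀ (a : (↥(maximalRealSubfield L))ˣ) (χ : Chi (↥(maximalRealSubfield L)) L (IsCMField.complexConj L)),
                P.HasFinComponent
                  (rhoAtLine (↥(maximalRealSubfield L)) L (IsCMField.complexConj L) 3 e₁ (Matrix.diagonal dV)
                    (complexConj_imagUnit L) (imagUnit_ne_zero L) (imagUnit_mul_self L) (realDiagonal_isSymm L dV hdV)
                    (isUnit_det_realDiagonal L dV hdV hdV0) (realDiagonal_map L dV hdV).symm
                    (fun a => isCompatible_chiSplittingLine L e₁ dV hdV hdV0 (toHeckeCharacter L μ)
                      (isUnitary_toHeckeCharacter L μ) ((isOscillatorChar_toHeckeCharacter_iff μ).mpr hμ)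
                      (TW (↥(maximalRealSubfield L)) a) (isSymm_TW (↥(maximalRealSubfield L)) a)
                      (isUnit_det_TW (↥(maximalRealSubfield L)) a) (JW (↥(maximalRealSubfield L)) L a)
                      (JW_eq (↥(maximalRealSubfield L)) L a)) ιV a χ) →
                  Even ({v : HeightOneSpectrum (𝓞 ↥(maximalRealSubfield L)) |
                          locF (↥(maximalRealSubfield L)) (imagUnitSq L) a v ≠ 1}.ncard +
                    {φ : L →+* ℂ | φ ∈ hμ.cmType.1 ∧ 0 < (φ (2 * imagUnit L)⁻¹).im}.ncard)) :
    StubU4SignRule :=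
  P2StubU4OfParity.stubU4_of_parity (stubE3_of_E3flat hE)

end Summit.HodgeConjecture.HodgeConjecture.Cruxes.H413.F0P2fE3OfRung2

end
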